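import Summits.QuantumFields.YangMills.Theorems.UnitScaleTiltProp7Lane2BoxPlateauCutoff
import HarnessLib

/-!
# Route `UnitScaleTilt`, crux K1 «MinimiserStabilityRegPr» (stmt-QuantumFields-19200), LANE II «DIVERGENCE RECOVERY AT CURVED `W`» (★★OWNER RULING №23), [I-9] (P2)
# «PEEL, DON'T RE-ANCHOR» (★p1 g19 NAMER WORD №16): **THE CORNER'S BLOCK IN THE BASE CHART** — the one-line link between px9's (a′) FILE 6c peel condition
# (`cycDist_src_le_of_mem_image`, block vector `B` read as the coarse site `κ ↦ ↑(B κ)`) and the `hch` row of ✓p721352 `Prop7Lane2BoxPlateauCutoff.boxPlateau_eq_one_on_readSet`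
# (centred at the coarse site `C` whose CORNER is the p.o.u. centre `c`): `B′ := (val c − val basePt)∕ℓ = C − 1`, so the instantiation is `B := B′ + 1` and the peel is `p = 5`.

Cell `ym3-torus` (HUMAN RULING D-0037, YM ladder rung R3 — YM₃ on T³ is a rung, NOT d = 4, NOT infinite volume, NOT a mass gap, NOT Clay; YM gap NOT proved), width seat
`ym-ust-19200-w1` (gen 16).  THEOREMS ONLY (0 `def`, 0 `sorry`); `--supports stmt-QuantumFields-19200 --as helper`; count-neutral.

WHAT IS PROVED (`ℓ = L^{K−n}` odd `≥ 3`, `val basePt = (ℓ−1)∕2` by ✓`val_basePt`, `val c = C.val·ℓ` by px9 ✓`val_corner`; `dist(a,b) = min (a−b).val (b−a).val` on `T^{(K−n)}`):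
* ★`cornerBlock_eq` — `(val c κ − val basePt κ) ∕ ℓ = (C κ).val − 1` (integer division; remainder `(ℓ+1)∕2`): px9 ✓`blockBox_tiled`'s block vector `B′` of the record chart box
  around the corner centre is `C − 1`, so the box is the comb cube `lo + [0, 4L^s+2]^d` with `lo = C − 2L^s − 2`.
* ★`cornerBlock_cast` — `(((val c κ − val basePt κ) ∕ ℓ + 1 : ℤ) : ZMod N_{K−n}) = C κ`: the block vector `B′ + 1`, read as a coarse site, IS `C`.
* ★★`dist_add_three_le_of_cycDist_cornerBlock` — px9's 6c conclusion at `B := B′ + 1` with any `D`, `D + 3 ≤ 2L^s` ⟹ `∀ κ, dist(ĉ₋ κ, C κ) + 3 ≤ 2L^s` (the `hch` row).  With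
  `D := 2L^s − 3` the margins `B ≤ lo′ + D`, `lo′ + m′ ≤ B + D` of 6c hold at `lo′ = lo + 5`, `m′ = 4L^s − 8` (`p = 5`; `hlo` with equality, `hhi` with slack `2`) and FAIL at
  `p = 4` by one layer — so PATCHES1 calls px9's `peeled_tiled … lo (4L^s+2) 5 …` ▸ `h7h8_member_peeled … 5 …` (needs `2 ≤ L^s`).
HONEST SCOPE.  Integer ∕ residue bookkeeping; nothing of the lattice gauge theory, of `hPatch`∕(REC)∕hN06∕EX∕the crux is claimed.

References: T. Bałaban, CMP **99** (1985) 389–434 [Balaban1985BackgroundPropagators] ((3.100) p.413: localisation to cubes at scale `M`); CMP **98** (1985) 17–51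
[Balaban1985Averaging] (pp.24–25: block cubes); [folklore].
-/

set_option autoImplicit false

noncomputable section

namespace Summit.QuantumFields.YangMills.Theorems.Prop7Lane2BoxPlateauPeel

open Literature.MathematicalPhysics.QuantumFieldTheory.Balaban1983to89
open Literature.MathematicalPhysics.QuantumFieldTheory.Balaban1983to89.T3ContinuumYM3Torus
open Summit.QuantumFields.YangMills.Theorems.Prop7SPrint (basePt)
open Summit.QuantumFields.YangMills.Theorems.Prop7Lane2PlateauCutoff (val_corner)
open Summit.QuantumFields.YangMills.Theorems.Prop7Lane2BoxPlateauCutoff (val_basePt)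

variable (F : T3Family) (n K s : ℕ)

section Corner

variable (C : Site (F.P K) (K - n)) (c : Site (F.P K) 0)
  (hc : ∀ κ : Fin 3, c κ = (((C κ).val * F.L ^ (K - n) : ℕ) : ZMod ((F.P K).sitesPerDir 0)))
include hc

/-- ★ **THE CORNER'S BLOCK IN THE BASE CHART**: `(val c − val basePt) ∕ ℓ = C.val − 1` — px9 ✓`blockBox_tiled`'s block vector `B′` at the corner centre is `C − 1` (the corner
`c` of torus block `C` sits `(ℓ+1)∕2` sites into comb block `C − 1` of the base chart). [folklore] -/
theorem cornerBlock_eq (hnK : n < K) (κ : Fin 3) :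
    ((((c κ).val : ℕ) : ℤ) - ((((basePt F n K) κ).val : ℕ) : ℤ)) / ((F.L ^ (K - n) : ℕ) : ℤ) = (((C κ).val : ℕ) : ℤ) - 1 := by
  rw [hc κ, val_corner F n K hnK.le C κ, val_basePt F n K κ]
  obtain ⟨k, hk⟩ : Odd (F.L ^ (K - n)) := F.hL.1.pow
  have hL3 : 3 ≤ F.L := by
    obtain ⟨r, hr⟩ := F.hL.1
    have := F.hL.2
    omega
  have hℓ3 : 3 ≤ F.L ^ (K - n) := by
    calc 3 ≤ F.L := hL3
      _ = F.L ^ 1 := (pow_one _).symm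
      _ ≤ F.L ^ (K - n) := Nat.pow_le_pow_right (by omega) (by omega)
  have hk1 : 1 ≤ k := by omega
  have hdiv2 : (F.L ^ (K - n) - 1) / 2 = k := by omega
  rw [hdiv2]
  have hℓZ : ((F.L ^ (K - n) : ℕ) : ℤ) = 2 * (k : ℤ) + 1 := by exact_mod_cast hk
  have hℓZ' : (F.L : ℤ) ^ (K - n) = 2 * (k : ℤ) + 1 := by exact_mod_cast hk
  have e1 : ((((C κ).val * F.L ^ (K - n) : ℕ) : ℤ)) = ((C κ).val : ℤ) * (2 * (k : ℤ) + 1) := by push_cast; rw [hℓZ']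
  rw [e1, hℓZ]
  have e2 : ((C κ).val : ℤ) * (2 * (k : ℤ) + 1) - (k : ℤ) = ((k : ℤ) + 1) + (2 * (k : ℤ) + 1) * (((C κ).val : ℤ) - 1) := by ring
  rw [e2, Int.add_mul_ediv_left _ _ (by omega : (2 * (k : ℤ) + 1) ≠ 0), Int.ediv_eq_zero_of_lt (by omega) (by omega), zero_add]

/-- ★ **`B′ + 1`, READ AS A COARSE SITE, IS `C`**: `(((val c − val basePt) ∕ ℓ + 1 : ℤ) : ZMod N_{K−n}) κ = C κ` — px9's 6c `cycDist_src_le_of_mem_image` at the block vector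
`B := B′ + 1` speaks about cyclic distances to `C` itself. [folklore] -/
theorem cornerBlock_cast (hnK : n < K) (κ : Fin 3) :
    (((((((c κ).val : ℕ) : ℤ) - ((((basePt F n K) κ).val : ℕ) : ℤ)) / ((F.L ^ (K - n) : ℕ) : ℤ) + 1 : ℤ)) : ZMod ((F.P K).sitesPerDir (K - n))) = C κ := by
  rw [cornerBlock_eq F n K C c hc hnK κ, sub_add_cancel, Int.cast_natCast, ZMod.natCast_zmod_val]

/-- ★★ **THE PEEL CONDITION LANDS ON `hch`**: if a coarse bond's source is within coarse cyclic sup-distance `D` of the block vector `B′ + 1` read as a coarse site (px9's 6c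
`cycDist_src_le_of_mem_image` at `B := fun κ => (val c κ − val basePt κ)∕ℓ + 1`, margins `B ≤ lo′ + D`, `lo′ + m′ ≤ B + D`) and `D + 3 ≤ 2L^s`, then
`dist(ĉ₋ κ, C κ) + 3 ≤ 2L^s` in every direction — the `hch` row of ✓`boxPlateau_eq_one_on_readSet` (so the `hS` row of ✓`coarseGrad_rows_on_inner` at the box-plateau
cutoff holds on the peeled index set; record numbers `D = 2L^s − 3`, `lo′ = lo + 5`, `m′ = 4L^s − 8`). [cite: Balaban1985BackgroundPropagators, (3.100) p.413] -/
theorem dist_add_three_le_of_cycDist_cornerBlock (hnK : n < K) (D : ℕ) (hD3 : D + 3 ≤ 2 * F.L ^ s) (chat : PBond (F.P K) (K - n))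
    (hD : ∀ κ : Fin (F.P K).d,
      min (chat.src κ - (((((((c κ).val : ℕ) : ℤ) - ((((basePt F n K) κ).val : ℕ) : ℤ)) / ((F.L ^ (K - n) : ℕ) : ℤ) + 1 : ℤ)) : ZMod ((F.P K).sitesPerDir (K - n)))).val
          ((((((((c κ).val : ℕ) : ℤ) - ((((basePt F n K) κ).val : ℕ) : ℤ)) / ((F.L ^ (K - n) : ℕ) : ℤ) + 1 : ℤ)) : ZMod ((F.P K).sitesPerDir (K - n))) - chat.src κ).val ≤ D) :
    ∀ κ : Fin 3, min (chat.src κ - C κ).val (C κ - chat.src κ).val + 3 ≤ 2 * F.L ^ s := by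
  intro κ
  have h := hD κ
  rw [cornerBlock_cast F n K C c hc hnK κ] at h
  omega

end Corner

end Summit.QuantumFields.YangMills.Theorems.Prop7Lane2BoxPlateauPeel

end
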